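import Mathlib
import HarnessLib

/-!
# The Karnin–Shpilka rank distance between products of affine forms (ORBIT currency)

Route MonotoneRestoration, crux `OrbitRestorationQP` (stmt-ValiantsHypothesis-18293), line `depth-three-rung`,
registered stub `stub_sigmaPiSigmaKValue` (A_k).  Namespace
`Summit.ValiantsHypothesis.ValiantsHypothesis.Theorems.RankDistance`.  Route-independent (no `Theses` import).

Layer L2 of the formalisation plan of `Cruxes/OrbitRestorationQP/Lines/depth-three-rung-stubA-bounded-fanin.md`
(§1, §8): a product of affine forms is recorded by the MULTISET of its NORMALISED factors (`nrm q`, the canonical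
representative of the associate class of `q`, so that two factor multisets of the same nonzero product agree), and
the rank distance of two such multisets is

  `Δ(L, L') = finrank (span ((L - L') + (L' - L)))`,

the rank of the simple part of the pair (Karnin–Shpilka 2009, §3).  Proved here: `Δ(L,L) = 0`, symmetry, the
TRIANGLE INEQUALITY (a form counted differently in `L` and `L''` is counted differently in `L` and `L'` or in `L'`
and `L''`), invariance under a linear automorphism followed by re-normalisation (`rdist_act`), and the two bounds
used by the structure theorem: inside a family, `Δ(L_i, L_j)` is at most the rank of the family divided by its gcd
(`rdist_le_finrank_simplePart`), and the span of the gcd-free forms of a family is controlled by the pairwise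
distances (`simpleSpan_le_sum`).

Everything is proved. [folklore; cite: KarninShpilka2009, §3 (rank distance); SaxenaSeshadhri2013, Def. 1]
-/

noncomputable section

open Multiset

-- `Summit.ValiantsHypothesis.ValiantsHypothesis.…` is the tree's single-conjunct layout (Sub = Summit).
set_option linter.dupNamespace false

namespace Summit.ValiantsHypothesis.ValiantsHypothesis.Theorems

namespace RankDistance

universe u

variable {K : Type} [Field K] {X : Type}

/-! ### Normalised representatives of associate classes -/

/-- The canonical representative of the associate class of `q` (so `nrm q = nrm q'` iff `q ~ᵤ q'`). [folklore] -/
def nrm (q : MvPolynomial X K) : MvPolynomial X K := Quot.out (Associates.mk q)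

/-- `nrm q` is an associate of `q`. [folklore] -/
theorem nrm_associated (q : MvPolynomial X K) : Associated (nrm q) q := Associates.mk_quot_out q

/-- Associates have the same normalisation. [folklore] -/
theorem nrm_eq_of_associated {q q' : MvPolynomial X K} (h : Associated q q') : nrm q = nrm q' := by
  unfold nrm
  rw [Associates.mk_eq_mk_iff_associated.2 h]

/-- Equal normalisations means associated. [folklore] -/
theorem associated_of_nrm_eq {q q' : MvPolynomial X K} (h : nrm q = nrm q') : Associated q q' :=
  ((nrm_associated q).symm.trans (h ▸ nrm_associated q'))

/-- `nrm` is idempotent. [folklore] -/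
theorem nrm_nrm (q : MvPolynomial X K) : nrm (nrm q) = nrm q := nrm_eq_of_associated (nrm_associated q)

/-- `nrm q = C u * q` for a nonzero scalar `u` (units of `K[X]` are the nonzero constants). [folklore] -/
theorem exists_nrm_eq_C_mul (q : MvPolynomial X K) : ∃ u : K, u ≠ 0 ∧ nrm q = MvPolynomial.C u * q := by
  obtain ⟨w, hw⟩ := (nrm_associated q).symm
  obtain ⟨u, hu⟩ : ∃ u : K, (w : MvPolynomial X K) = MvPolynomial.C u := by
    have := MvPolynomial.isUnit_iff_eq_C_of_isReduced.1 w.isUnit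
    obtain ⟨u, -, hu⟩ := this
    exact ⟨u, hu⟩
  have hu0 : u ≠ 0 := by
    rintro rfl
    have h1 : IsUnit ((w : MvPolynomial X K)) := w.isUnit
    rw [hu, MvPolynomial.C_0] at h1
    exact not_isUnit_zero h1
  exact ⟨u, hu0, by rw [← hw, hu, mul_comm]⟩

/-- Normalisation preserves the total degree. [folklore] -/
theorem totalDegree_nrm (q : MvPolynomial X K) : (nrm q).totalDegree = q.totalDegree := by
  obtain ⟨u, hu0, h⟩ := exists_nrm_eq_C_mul q
  rw [h]
  by_cases hq : q = 0
  · simp [hq]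
  · rw [MvPolynomial.totalDegree_mul_of_isDomain (mt MvPolynomial.C_eq_zero.1 hu0) hq,
      MvPolynomial.totalDegree_C, zero_add]

/-- `nrm q = 0 ↔ q = 0`. [folklore] -/
theorem nrm_eq_zero_iff (q : MvPolynomial X K) : nrm q = 0 ↔ q = 0 := by
  obtain ⟨u, hu0, h⟩ := exists_nrm_eq_C_mul q
  rw [h, mul_eq_zero, MvPolynomial.C_eq_zero]
  simp [hu0]

/-! ### The rank distance -/

variable [DecidableEq (MvPolynomial X K)]

/-- The symmetric difference of two multisets. [folklore] -/
def sdiff2 (L L' : Multiset (MvPolynomial X K)) : Multiset (MvPolynomial X K) := (L - L') + (L' - L)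

/-- The span of (the members of) a multiset of polynomials. [folklore] -/
def mspan (L : Multiset (MvPolynomial X K)) : Submodule K (MvPolynomial X K) :=
  Submodule.span K {q | q ∈ L}

/-- **The Karnin–Shpilka rank distance** of two factor multisets: the rank of their simple part.
[cite: KarninShpilka2009, §3] -/
def rdist (L L' : Multiset (MvPolynomial X K)) : ℕ := Module.finrank K (mspan (sdiff2 L L'))

omit [DecidableEq (MvPolynomial X K)] in
/-- The span of a multiset is finite-dimensional. [folklore] -/
theorem mspan_finite (L : Multiset (MvPolynomial X K)) : FiniteDimensional K (mspan L) := by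
  classical
  unfold mspan
  have : {q | q ∈ L} = ((L.toFinset : Finset _) : Set (MvPolynomial X K)) := by ext q; simp
  rw [this]
  exact FiniteDimensional.span_finset K L.toFinset

/-- Membership in the symmetric difference is a statement about counts. [folklore] -/
theorem mem_sdiff2 {L L' : Multiset (MvPolynomial X K)} {q : MvPolynomial X K} :
    q ∈ sdiff2 L L' ↔ L.count q ≠ L'.count q := by
  unfold sdiff2
  rw [mem_add, ← count_pos, ← count_pos, count_sub, count_sub]
  omega

/-- `Δ(L, L) = 0`. [folklore] -/
theorem rdist_self (L : Multiset (MvPolynomial X K)) : rdist L L = 0 := by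
  unfold rdist mspan
  have : {q | q ∈ sdiff2 L L} = (∅ : Set (MvPolynomial X K)) := by
    ext q
    simp only [Set.mem_setOf_eq, mem_sdiff2, ne_eq, not_true_eq_false, Set.mem_empty_iff_false]
  rw [this, Submodule.span_empty]
  exact finrank_bot K _

/-- The simple span of a pair is finite-dimensional. [folklore] -/
theorem rdist_finite (L L' : Multiset (MvPolynomial X K)) : FiniteDimensional K (mspan (sdiff2 L L')) :=
  mspan_finite _

/-- Symmetry of the rank distance. [folklore] -/
theorem rdist_comm (L L' : Multiset (MvPolynomial X K)) : rdist L L' = rdist L' L := by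
  unfold rdist sdiff2
  rw [Multiset.add_comm]

omit [DecidableEq (MvPolynomial X K)] in
/-- `mspan` is monotone with respect to membership. [folklore] -/
theorem mspan_mono {L L' : Multiset (MvPolynomial X K)} (h : ∀ q ∈ L, q ∈ L') : mspan L ≤ mspan L' :=
  Submodule.span_mono fun q hq => h q hq

/-- **TRIANGLE INEQUALITY** for the rank distance. [cite: KarninShpilka2009, §3] -/
theorem rdist_triangle (L L' L'' : Multiset (MvPolynomial X K)) :
    rdist L L'' ≤ rdist L L' + rdist L' L'' := by
  unfold rdist
  haveI := rdist_finite L L'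
  haveI := rdist_finite L' L''
  have hsub : mspan (sdiff2 L L'') ≤ mspan (sdiff2 L L') ⊔ mspan (sdiff2 L' L'') := by
    unfold mspan
    rw [← Submodule.span_union]
    refine Submodule.span_mono fun q hq => ?_
    simp only [Set.mem_setOf_eq, Set.mem_union, mem_sdiff2] at hq ⊢
    by_contra h
    push Not at h
    exact hq (h.1.trans h.2)
  exact (Submodule.finrank_mono hsub).trans (Submodule.finrank_add_le_finrank_add_finrank _ _)

/-! ### Invariance under a linear automorphism followed by re-normalisation -/

/-- A multiset is NORMALISED if all its members are their own normal forms. [folklore] -/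
def IsNormalised (L : Multiset (MvPolynomial X K)) : Prop := ∀ q ∈ L, nrm q = q

/-- The action of an algebra automorphism on normalised factor multisets: apply and re-normalise. [folklore] -/
def act (φ : MvPolynomial X K ≃ₐ[K] MvPolynomial X K) (L : Multiset (MvPolynomial X K)) :
    Multiset (MvPolynomial X K) :=
  L.map fun q => nrm (φ q)

omit [DecidableEq (MvPolynomial X K)] in
/-- `act φ L` is normalised. [folklore] -/
theorem isNormalised_act (φ : MvPolynomial X K ≃ₐ[K] MvPolynomial X K) (L : Multiset (MvPolynomial X K)) :
    IsNormalised (act φ L) := by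
  intro q hq
  obtain ⟨q', -, rfl⟩ := mem_map.1 hq
  exact nrm_nrm _

omit [DecidableEq (MvPolynomial X K)] in
/-- `nrm ∘ φ` is injective on normalised polynomials. [folklore] -/
theorem nrm_map_injOn (φ : MvPolynomial X K ≃ₐ[K] MvPolynomial X K) {q q' : MvPolynomial X K}
    (hq : nrm q = q) (hq' : nrm q' = q') (h : nrm (φ q) = nrm (φ q')) : q = q' := by
  have h1 : Associated (φ q) (φ q') := associated_of_nrm_eq h
  have h2 : Associated q q' := by
    have := h1.map φ.symm.toAlgHom.toRingHom
    simpa using this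
  rw [← hq, ← hq', nrm_eq_of_associated h2]

/-- Counts in `act φ L` of the image of a member. [folklore] -/
theorem count_act (φ : MvPolynomial X K ≃ₐ[K] MvPolynomial X K) {L M : Multiset (MvPolynomial X K)}
    (hM : IsNormalised M) (hL : ∀ q ∈ L, q ∈ M) {q : MvPolynomial X K} (hq : q ∈ M) :
    (act φ L).count (nrm (φ q)) = L.count q := by
  unfold act
  by_cases hqL : q ∈ L
  · exact count_map_eq_count (fun q => nrm (φ q)) L
      (fun a ha b hb hab => nrm_map_injOn φ (hM a (hL a ha)) (hM b (hL b hb)) hab) q hqL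
  · rw [count_eq_zero_of_notMem hqL, count_eq_zero, mem_map]
    rintro ⟨q', hq'L, hqq'⟩
    have := nrm_map_injOn φ (hM q' (hL q' hq'L)) (hM q hq) hqq'
    rw [this] at hq'L
    exact hqL hq'L

/-- The symmetric difference commutes with the action (on normalised multisets). [folklore] -/
theorem mem_sdiff2_act (φ : MvPolynomial X K ≃ₐ[K] MvPolynomial X K) {L L' : Multiset (MvPolynomial X K)}
    (hL : IsNormalised L) (hL' : IsNormalised L') {p : MvPolynomial X K} :
    p ∈ sdiff2 (act φ L) (act φ L') ↔ ∃ q ∈ sdiff2 L L', p = nrm (φ q) := by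
  have hM : IsNormalised (L + L') := fun q hq => by
    rcases mem_add.1 hq with h | h
    · exact hL q h
    · exact hL' q h
  constructor
  · intro hp
    have hp' : p ∈ act φ L ∨ p ∈ act φ L' := by
      rw [mem_sdiff2] at hp
      by_contra h
      push Not at h
      rw [count_eq_zero_of_notMem h.1, count_eq_zero_of_notMem h.2] at hp
      exact hp rfl
    obtain ⟨q, hq, rfl⟩ : ∃ q ∈ L + L', p = nrm (φ q) := by
      rcases hp' with h | h
      · obtain ⟨q, hq, rfl⟩ := mem_map.1 h; exact ⟨q, mem_add.2 (Or.inl hq), rfl⟩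
      · obtain ⟨q, hq, rfl⟩ := mem_map.1 h; exact ⟨q, mem_add.2 (Or.inr hq), rfl⟩
    refine ⟨q, ?_, rfl⟩
    rw [mem_sdiff2] at hp ⊢
    rwa [count_act φ hM (fun q hq => mem_add.2 (Or.inl hq)) hq,
      count_act φ hM (fun q hq => mem_add.2 (Or.inr hq)) hq] at hp
  · rintro ⟨q, hq, rfl⟩
    have hqM : q ∈ L + L' := by
      rw [mem_sdiff2] at hq
      by_contra h
      rw [mem_add, not_or] at h
      rw [count_eq_zero_of_notMem h.1, count_eq_zero_of_notMem h.2] at hq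
      exact hq rfl
    rw [mem_sdiff2] at hq ⊢
    rwa [count_act φ hM (fun q hq => mem_add.2 (Or.inl hq)) hqM,
      count_act φ hM (fun q hq => mem_add.2 (Or.inr hq)) hqM]

omit [DecidableEq (MvPolynomial X K)] in
/-- The span of re-normalised images is the image of the span. [folklore] -/
theorem span_nrm_image (φ : MvPolynomial X K ≃ₐ[K] MvPolynomial X K) (S : Set (MvPolynomial X K)) :
    Submodule.span K ((fun q => nrm (φ q)) '' S) = (Submodule.span K S).map φ.toLinearEquiv.toLinearMap := by
  rw [Submodule.map_span]
  apply le_antisymm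
  · refine Submodule.span_le.2 ?_
    rintro _ ⟨q, hq, rfl⟩
    obtain ⟨u, -, hu⟩ := exists_nrm_eq_C_mul (φ q)
    change nrm (φ q) ∈ _
    rw [hu, ← MvPolynomial.smul_eq_C_mul]
    exact Submodule.smul_mem _ _ (Submodule.subset_span ⟨q, hq, rfl⟩)
  · refine Submodule.span_le.2 ?_
    rintro _ ⟨q, hq, rfl⟩
    obtain ⟨u, hu0, hu⟩ := exists_nrm_eq_C_mul (φ q)
    have : (φ.toLinearEquiv.toLinearMap q : MvPolynomial X K) = u⁻¹ • nrm (φ q) := by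
      rw [hu, MvPolynomial.smul_eq_C_mul, ← mul_assoc, ← map_mul, inv_mul_cancel₀ hu0, map_one, one_mul]
      rfl
    rw [this]
    exact Submodule.smul_mem _ _ (Submodule.subset_span ⟨q, hq, rfl⟩)

/-- **INVARIANCE**: the rank distance of normalised multisets is unchanged by the action of an algebra
automorphism (e.g. a renaming of the variables by a permutation). [folklore] -/
theorem rdist_act (φ : MvPolynomial X K ≃ₐ[K] MvPolynomial X K) {L L' : Multiset (MvPolynomial X K)}
    (hL : IsNormalised L) (hL' : IsNormalised L') : rdist (act φ L) (act φ L') = rdist L L' := by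
  unfold rdist mspan
  have hset : {p | p ∈ sdiff2 (act φ L) (act φ L')} = (fun q => nrm (φ q)) '' {q | q ∈ sdiff2 L L'} := by
    ext p
    rw [Set.mem_setOf_eq, mem_sdiff2_act φ hL hL']
    constructor
    · rintro ⟨q, hq, rfl⟩; exact ⟨q, hq, rfl⟩
    · rintro ⟨q, hq, rfl⟩; exact ⟨q, hq, rfl⟩
  rw [hset, span_nrm_image]
  exact LinearEquiv.finrank_map_eq _ _

/-! ### The two bounds used by the structure theorem -/

/-- The gcd-free forms of a family `L : ι → Multiset` over a finset `B`: members of some `L i - G` where `G` is the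
infimum of the `L i`, `i ∈ B`. [folklore] -/
def simplePart {ι : Type u} (L : ι → Multiset (MvPolynomial X K)) (B : Finset ι) (hB : B.Nonempty) :
    Set (MvPolynomial X K) :=
  {q | ∃ i ∈ B, q ∈ L i - B.inf' hB L}

/-- The gcd-free forms form a finite set. [folklore] -/
theorem simplePart_finite {ι : Type u} (L : ι → Multiset (MvPolynomial X K)) (B : Finset ι) (hB : B.Nonempty) :
    (simplePart L B hB).Finite := by
  refine Set.Finite.subset (s := ⋃ i ∈ B, {q | q ∈ L i}) ?_ ?_
  · exact Set.Finite.biUnion B.finite_toSet fun i _ => (L i).toFinset.finite_toSet.subset fun q hq => by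
      simpa using hq
  · intro q hq
    obtain ⟨i, hi, hq⟩ := hq
    simp only [Set.mem_iUnion, Set.mem_setOf_eq]
    exact ⟨i, hi, Multiset.mem_of_le (Multiset.sub_le_self _ _) hq⟩

/-- The span of the gcd-free forms is finite-dimensional. [folklore] -/
theorem simplePart_span_finite {ι : Type u} (L : ι → Multiset (MvPolynomial X K)) (B : Finset ι)
    (hB : B.Nonempty) : FiniteDimensional K (Submodule.span K (simplePart L B hB)) :=
  FiniteDimensional.span_of_finite K (simplePart_finite L B hB)

/-- **Inside a family, `Δ(L_i, L_j)` is at most the rank of its gcd-free forms.** [folklore] -/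
theorem rdist_le_finrank_simplePart {ι : Type u} (L : ι → Multiset (MvPolynomial X K)) (B : Finset ι)
    (hB : B.Nonempty) {i j : ι} (hi : i ∈ B) (hj : j ∈ B) :
    rdist (L i) (L j) ≤ Module.finrank K (Submodule.span K (simplePart L B hB)) := by
  haveI := simplePart_span_finite L B hB
  unfold rdist mspan
  refine Submodule.finrank_mono (Submodule.span_mono fun q hq => ?_)
  rw [Set.mem_setOf_eq, mem_sdiff2] at hq
  simp only [simplePart, Set.mem_setOf_eq]
  have hGi : (B.inf' hB L).count q ≤ (L i).count q := Multiset.count_le_of_le _ (Finset.inf'_le L hi)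
  have hGj : (B.inf' hB L).count q ≤ (L j).count q := Multiset.count_le_of_le _ (Finset.inf'_le L hj)
  rcases Nat.lt_or_gt_of_ne hq with h | h
  · refine ⟨j, hj, ?_⟩
    rw [← count_pos, count_sub]; omega
  · refine ⟨i, hi, ?_⟩
    rw [← count_pos, count_sub]; omega

/-- The count of `q` in a finite infimum of multisets is the infimum of the counts. [folklore] -/
theorem count_inf' {ι : Type u} (L : ι → Multiset (MvPolynomial X K)) (B : Finset ι) (hB : B.Nonempty)
    (q : MvPolynomial X K) : (B.inf' hB L).count q = B.inf' hB fun l => (L l).count q := by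
  refine le_antisymm ?_ ?_
  · exact (Finset.le_inf'_iff hB _).2 fun l hl => Multiset.count_le_of_le _ (Finset.inf'_le L hl)
  · rw [Multiset.le_count_iff_replicate_le]
    refine (Finset.le_inf'_iff hB _).2 fun l hl => ?_
    rw [← Multiset.le_count_iff_replicate_le]
    exact Finset.inf'_le (fun l => (L l).count q) hl

/-- **The gcd-free forms are controlled by the pairwise distances**: every member of `L i - G` lies in the symmetric
difference of `L i` and some `L j`, `j ∈ B` (the one realising the minimal count). [folklore] -/
theorem simplePart_subset {ι : Type u} (L : ι → Multiset (MvPolynomial X K)) (B : Finset ι) (hB : B.Nonempty) :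
    simplePart L B hB ⊆ ⋃ i ∈ B, ⋃ j ∈ B, {q | q ∈ sdiff2 (L i) (L j)} := by
  intro q hq
  obtain ⟨i, hi, hq⟩ := hq
  obtain ⟨j, hj, hjmin⟩ := Finset.exists_mem_eq_inf' hB fun l => (L l).count q
  simp only [Set.mem_iUnion, Set.mem_setOf_eq, mem_sdiff2]
  refine ⟨i, hi, j, hj, ?_⟩
  rw [← count_pos, count_sub, count_inf' L B hB q, hjmin] at hq
  omega

omit [DecidableEq (MvPolynomial X K)] in
/-- The dimension of a finite supremum of finite-dimensional subspaces is at most the sum of the dimensions.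
[folklore] -/
theorem finrank_finset_sup_le {ι : Type u} {V : Type} [AddCommGroup V] [Module K V] (s : Finset ι)
    (S : ι → Submodule K V) [∀ i, FiniteDimensional K (S i)] :
    Module.finrank K (s.sup S : Submodule K V) ≤ ∑ i ∈ s, Module.finrank K (S i) := by
  classical
  induction s using Finset.induction_on with
  | empty => simp
  | insert a s ha ih =>
    rw [Finset.sup_insert, Finset.sum_insert ha]
    exact (Submodule.finrank_add_le_finrank_add_finrank _ _).trans (Nat.add_le_add_left ih _)

/-- The span of the gcd-free forms is at most the sum of the pairwise rank distances. [folklore] -/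
theorem finrank_simplePart_le {ι : Type u} (L : ι → Multiset (MvPolynomial X K)) (B : Finset ι) (hB : B.Nonempty) :
    Module.finrank K (Submodule.span K (simplePart L B hB)) ≤ ∑ i ∈ B, ∑ j ∈ B, rdist (L i) (L j) := by
  haveI : ∀ i j, FiniteDimensional K (mspan (sdiff2 (L i) (L j))) := fun i j => rdist_finite _ _
  have hle : Submodule.span K (simplePart L B hB) ≤ B.sup fun i => B.sup fun j => mspan (sdiff2 (L i) (L j)) := by
    refine Submodule.span_le.2 fun q hq => ?_
    have := simplePart_subset L B hB hq
    simp only [Set.mem_iUnion, Set.mem_setOf_eq] at this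
    obtain ⟨i, hi, j, hj, hq'⟩ := this
    have h1 : mspan (sdiff2 (L i) (L j)) ≤ B.sup fun i => B.sup fun j => mspan (sdiff2 (L i) (L j)) :=
      le_trans (Finset.le_sup (f := fun j => mspan (sdiff2 (L i) (L j))) hj)
        (Finset.le_sup (f := fun i => B.sup fun j => mspan (sdiff2 (L i) (L j))) hi)
    exact h1 (Submodule.subset_span hq')
  refine (Submodule.finrank_mono hle).trans ?_
  refine (finrank_finset_sup_le B _).trans (Finset.sum_le_sum fun i _ => ?_)
  exact finrank_finset_sup_le B _

end RankDistance

end Summit.ValiantsHypothesis.ValiantsHypothesis.Theorems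

end
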